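import Summits.Ventures.HSemireg.WedgeHankelOuterIndependence
import Summits.Ventures.HSemireg.WedgeApolarSpikes
import Summits.Ventures.HSemireg.WedgeHankelSubstitutionCatalecticant

/-!
# Venture HSemireg — THE HANKEL MATRIX IS THE MATRIX OF THE CLASS MAP: a class `w_k(c)` of the sub-box of the first `k` pairs kills the box class `w_N(q)` iff `c` is apolar to
# every window `σ^t q`, `t ≤ N − k`, i.e. **iff the vector `v_r = (−1)^r C(k,r) c_{k−r}` lies in the LEFT KERNEL of the Hankel matrix `H_k(q) = (q_{r+t})`** — th-6/th-7's FN-4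
# «rank(⌟v ∣ HT^k) = C(n,k) · rank H_k(v)» as an identity of MATRICES, not only of ranks (every field; when `C(k,r) ≠ 0` in `K` the twist `c ↦ v` is invertible)

HONEST FRAMING. Part of the Lean index of the computation cell `pub-hsemireg` (seat p10 gen 24, Sunday typer «UNIFORM-IN-n»).
Finite-dimensional EXTERIOR ALGEBRA over a field + th-7's apolar pairing ONLY: no variety, no cohomology theory, no sheaf, no Ext group, no semiregularity map;
nothing here says that HC / HC_CM / HC_AV holds; no Literature fact is declared or used.  Custodian versions as in `WedgeHankelSiegelIdeal` (1/3) and `WedgeApolarPairing` (I14); the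
dictionary (`w_k(c)` = a polynomial-in-Θ class of the sub-product of the first `k` factors; `H_k(q)` = the catalecticant of `v = Σ q_j Θ^j/j!`) is QUOTED, never asserted.

WHAT IS IN THE TREE.  K37/K38 (`WedgeHankelOuterExpansion`, `…Independence`): `w_eq_sum_powerset_Ico` (the outer expansion `w_N(q) = Σ_{S ⊆ [k,N)} w_k(σ^{|S|} q) · Π_S`) and
**`mul_w_eq_zero_iff_forall_shift`** (a form on the first `k` pairs kills `w_N(q)` iff it kills every `w_k(σ^t q)`, `t ≤ N − k`); I14 (`WedgeApolarPairing`): **`w_mul_w`** (`w_k(c) ∧ w_k(q′) =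
apolar_k(c, q′) · Π_{a<k} x_a y_a`), `volProd_ne_zero`; I16 (`WedgeApolarSpikes`): `apolar_eq_sum_spike_left`, `apolar_spike_right`, `apolar_swap`; H7 `shift_iterate_apply`; th-7's `hankel1`.
THIS FILE (namespace `Summit.Ventures.HSemireg.Wedge.HankelOuter` continued):
* §415 **`w_mul_w_top_eq_zero_iff_forall_apolar`**: `w K N k c ∧ w K N N q = 0 ↔ ∀ t ≤ N − k, apolar K k c (σ^t q) = 0` (`k ≤ N`) — a sub-box class kills the box class iff it is
  apolar to every window of `q`.
* §416 THE PAIRING IN CLOSED FORM: **`apolar_eq_sign_mul_sum_choose`**: `apolar K k c q′ = (−1)^k (−1)^{k(k−1)/2} · Σ_{r ≤ k} (−1)^r C(k,r) c_{k−r} q′_r`; `apolar_shift_iterate_eq`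
  (against the window `σ^t q`: `… Σ_r (−1)^r C(k,r) c_{k−r} q_{r+t}` = a signed entry of `v ᵥ* H_k(q)`), `vecMul_twist_hankel1_apply`.
* §417 **THE MATRIX IDENTITY `w_mul_w_top_eq_zero_iff_vecMul_hankel1`: `w K N k c ∧ w K N N q = 0 ↔ (fun r => (−1)^r C(k,r) c_{k−r}) ᵥ* hankel1 K N k q = 0`** (`k ≤ N`, every field,
  every `c`, `q`), and `w_mem_Kr_w_iff_vecMul_hankel1` (kernel form on `Hom(Dm k, k)`).
READING: the kernel of th-7's class map on the `(k+1)`-dimensional space of sub-box classes `w_k(c)` (a complement of the Siegel piece when the binomials `C(k,r)` are units, I16) is the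
left kernel of the catalecticant `H_k(q)` transported by the universal twist `c_{k−r} ↦ (−1)^r C(k,r) c_{k−r}`; THEOREM H's `rank H_k(q)` per `k`-set of pairs (L4/M5) is this matrix's
rank.  In characteristic `p ≤ k` the twist kills the `c_{k−r}` with `p ∣ C(k,r)` — exactly I16's classes that are Siegel forms.  Nothing Ext-side.  New names only.
-/

open Module

namespace Summit.Ventures.HSemireg.Wedge.HankelOuter

open Summit.Ventures.HSemireg.Wedge Summit.Ventures.HSemireg.Wedge.Kunneth Summit.Ventures.HSemireg.Wedge.Hankel
  Summit.Ventures.HSemireg.Wedge.BasisFree Summit.Ventures.HSemireg.Wedge.HankelSiegel Summit.Ventures.HSemireg.Wedge.HankelSiegelIdeal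
  Summit.Ventures.HSemireg.Wedge.KunnethKernel Summit.Ventures.HSemireg.Wedge.HankelFrameChange Summit.Ventures.HSemireg.Wedge.KernelDuality

variable (K : Type*) [Field K] {N : ℕ}

/-! ## §415. A sub-box class kills the box class iff it is apolar to every window -/

/-- **`w_k(c) ∧ w_N(q) = 0 ↔ ∀ t ≤ N − k, apolar_k(c, σ^t q) = 0`** (`k ≤ N`): by the outer expansion the product vanishes iff `w_k(c) ∧ w_k(σ^t q) = 0` for every window, and that
product is `apolar_k(c, σ^t q)` times the (non-zero) volume product of the first `k` pairs. -/
theorem w_mul_w_top_eq_zero_iff_forall_apolar {k : ℕ} (hk : k ≤ N) (c q : ℕ → K) :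
    w K N k c * w K N N q = 0 ↔ ∀ t ≤ N - k, apolar K k c ((shift K)^[t] q) = 0 := by
  rw [mul_w_eq_zero_iff_forall_shift K hk le_rfl q (Hom_le_Alg K _ _ (w_mem_Hom K hk c))]
  refine forall_congr' fun t => forall_congr' fun _ => ?_
  rw [w_mul_w K hk, smul_eq_zero, or_iff_left (volProd_ne_zero K hk)]

/-! ## §416. The pairing in closed form: a signed, binomially twisted row of the Hankel matrix -/

/-- **`apolar_k(c, q′) = (−1)^k (−1)^{k(k−1)/2} · Σ_{r ≤ k} (−1)^r C(k,r) c_{k−r} q′_r`** (I16's spike expansion, swapped and reflected). -/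
theorem apolar_eq_sign_mul_sum_choose (k : ℕ) (c q' : ℕ → K) :
    apolar K k c q' = (-1) ^ k * (-1) ^ (k * (k - 1) / 2) * ∑ r ∈ Finset.range (k + 1), (-1) ^ r * (k.choose r : K) * c (k - r) * q' r := by
  rw [apolar_eq_sum_spike_left, Finset.mul_sum, ← Finset.sum_range_reflect]
  refine Finset.sum_congr rfl fun r hr => ?_
  have hrk : r ≤ k := by have := Finset.mem_range.mp hr; omega
  rw [show k + 1 - 1 - r = k - r by omega, apolar_swap, apolar_spike_right K k q' (Nat.sub_le k r), Nat.sub_sub_self hrk]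
  ring

/-- against the window `σ^t q`: **`apolar_k(c, σ^t q) = (−1)^k (−1)^{k(k−1)/2} · Σ_{r ≤ k} (−1)^r C(k,r) c_{k−r} q_{r+t}`.** -/
theorem apolar_shift_iterate_eq (k t : ℕ) (c q : ℕ → K) :
    apolar K k c ((shift K)^[t] q) = (-1) ^ k * (-1) ^ (k * (k - 1) / 2) * ∑ r ∈ Finset.range (k + 1), (-1) ^ r * (k.choose r : K) * c (k - r) * q (r + t) := by
  rw [apolar_eq_sign_mul_sum_choose]
  congr 1
  exact Finset.sum_congr rfl fun r _ => by rw [shift_iterate_apply]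

/-- the entries of the twisted vector against the Hankel matrix: **`((fun r => (−1)^r C(k,r) c_{k−r}) ᵥ* H_k(q)) t = Σ_{r ≤ k} (−1)^r C(k,r) c_{k−r} q_{r+t}`.** -/
theorem vecMul_twist_hankel1_apply (k : ℕ) (c q : ℕ → K) (t : Fin (N + 1 - k)) :
    Matrix.vecMul (fun r : Fin (k + 1) => (-1) ^ (r : ℕ) * (k.choose (r : ℕ) : K) * c (k - (r : ℕ))) (hankel1 K N k q) t
      = ∑ r ∈ Finset.range (k + 1), (-1) ^ r * (k.choose r : K) * c (k - r) * q (r + (t : ℕ)) := by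
  rw [Matrix.vecMul, dotProduct, Finset.sum_range (fun r => (-1) ^ r * (k.choose r : K) * c (k - r) * q (r + (t : ℕ)))]
  refine Finset.sum_congr rfl fun r _ => ?_
  simp only [hankel1, Matrix.of_apply]

/-! ## §417. The matrix identity -/

/-- **THE HANKEL MATRIX IS THE MATRIX OF THE CLASS MAP: `w_k(c) ∧ w_N(q) = 0 ↔ (fun r => (−1)^r C(k,r) c_{k−r}) ᵥ* H_k(q) = 0`** (`k ≤ N`, every field, every coefficient sequence `c` of
the sub-box class and every `q`): the class map on the sub-box classes is, in the coordinates `c`, the catalecticant `H_k(q)` acting on the left, up to the universal twist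
`c_{k−r} ↦ (−1)^r C(k,r) c_{k−r}` (invertible when `k!` is a unit). -/
theorem w_mul_w_top_eq_zero_iff_vecMul_hankel1 {k : ℕ} (hk : k ≤ N) (c q : ℕ → K) :
    w K N k c * w K N N q = 0
      ↔ Matrix.vecMul (fun r : Fin (k + 1) => (-1) ^ (r : ℕ) * (k.choose (r : ℕ) : K) * c (k - (r : ℕ))) (hankel1 K N k q) = 0 := by
  rw [w_mul_w_top_eq_zero_iff_forall_apolar K hk]
  have hs : ((-1 : K) ^ k * (-1) ^ (k * (k - 1) / 2)) ≠ 0 :=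
    mul_ne_zero (pow_ne_zero _ (neg_ne_zero.mpr one_ne_zero)) (pow_ne_zero _ (neg_ne_zero.mpr one_ne_zero))
  constructor
  · intro h
    funext t
    have ht := h (t : ℕ) (by have := t.2; omega)
    rw [apolar_shift_iterate_eq, mul_assoc, mul_eq_zero, or_iff_right (pow_ne_zero _ (neg_ne_zero.mpr one_ne_zero)), mul_eq_zero,
      or_iff_right (pow_ne_zero _ (neg_ne_zero.mpr one_ne_zero))] at ht
    rw [vecMul_twist_hankel1_apply, Pi.zero_apply]
    exact ht
  · intro h t ht
    have h1 := congr_fun h ⟨t, by omega⟩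
    rw [vecMul_twist_hankel1_apply, Pi.zero_apply] at h1
    rw [apolar_shift_iterate_eq, h1, mul_zero]

/-- kernel form: **`w_k(c) ∈ Kr(Dm k, w_N(q), k) ↔ (fun r => (−1)^r C(k,r) c_{k−r}) ᵥ* H_k(q) = 0`** (`k ≤ N`). -/
theorem w_mem_Kr_w_iff_vecMul_hankel1 {k : ℕ} (hk : k ≤ N) (c q : ℕ → K) :
    w K N k c ∈ Kr K (Dm N k) (w K N N q) k
      ↔ Matrix.vecMul (fun r : Fin (k + 1) => (-1) ^ (r : ℕ) * (k.choose (r : ℕ) : K) * c (k - (r : ℕ))) (hankel1 K N k q) = 0 := by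
  rw [mem_Kr, and_iff_right (w_mem_Hom K hk c), w_mul_w_top_eq_zero_iff_vecMul_hankel1 K hk]

end Summit.Ventures.HSemireg.Wedge.HankelOuter
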